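import Summits.BirchSwinnertonDyer.Rank1Residual.X5.TwoAdicTargets
import Summits.BirchSwinnertonDyer.Rank1Residual.Partition.CornersCM
import HarnessLib

/-!
# Sub-lane «bsd-p2»: the CLASS PARTITION AT `2` as a finite grid, and for each class the exact
# `BSD(E,2)` statement the lane aims at (LEAN TYPER, unit `b2b-bsdres-p2-typer`)

HONEST FRAMING (sub-lane «bsd-p2», run/shared/lean/b2b/bsd-rank1-residual/p2/, verbatim in every
file): the target of record is the FULL Birch–Swinnerton-Dyer formula for EVERY analytic-rank `≤ 1`
`E/ℚ` at ALL primes INCLUDING `2`; the odd-prime class ledger is referee A's; the `2`-part is OPEN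
(cells O1 = X5 ∖ CM and O12 = the CM corner) and under census by «bsd-p2». Census / instrument
output at `2` = EVIDENCE / conjecture items with held-out validation, NEVER a Literature fact;
certificates close PAIRS (one isogeny class, `p = 2`), never classes. This file asserts NO
arithmetic fact: every `def … : Prop` is a TARGET (nothing asserted) or a PREDICATE assembled from
the tree's existing predicates, and every theorem is bookkeeping over them. Nothing booked; no mark
of RESIDUAL-MAP moved. Coordinator ruling 2026-08-21T22:39:51Z (HOME INBOX l.7632), mandate (ii)
"CLASS PARTITION AT 2 (reduction type at 2, mod-2/mod-4 image, CM, twist family)" and the typer's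
seat "for each class of the partition at 2, type the exact BSD-at-2 statement the lane aims at …
so that a closed class is a kernel object"; placement `Rank1Residual/P2/` per the o1 lead's D48 §6
(4) (no double typing: `X5/` and `Supersingular/` stay cc-typer-4's; every predicate below is
REUSED by name from `Rank1Residual.Predicates`, `X5/TwoAdicTargets.lean` (p249352) and
`Partition/CornersCM.lean`). Plan: HOME/p2/typer/TYPING-PLAN.md.

## Contents

* §0 The one schema. A *class at `2`* is a predicate `C : ClassAtTwo` on globally minimal elliptic
  `W/ℚ`; its exact BSD-at-2 statement is
  `BSDTwoOn C := ∀ W, analyticRank W ≤ 1 → C W → BSDp W 2` (Miller 2011 Def. 1.1 at `p = 2`). The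
  TARGET OF RECORD at `2` is `BSDTwoRankLeOne := BSDTwoOn ⊤`. API: antitone in `C`, finite unions,
  and the census-currency lemma `bsdTwoOn_of_forall_missingPPartAt`: the pair datum the census
  certifies, `MissingPPartAt W 2` (`#Ш_an = q ∈ ℚ` with `ord₂ q = ord₂ #Ш`; PLAN.md §0's
  "`a₂(E) = s₂(E)`"), given for EVERY member of `C`, is `BSDTwoOn C` (granted GZK) — one certificate
  discharges one instance, never the `∀`.
* §1 The grid `CellAtTwo` = rank bit × `RedTwo` (reduction at `2`: goodOrd / goodSS / multSplit /
  multNonsplit / addv = O1's five sub-cells, census column `red_E`) × `ImgTwo` (surj8 / surjNot8 /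
  cyclic3 / borel = census `img_E` with the mod-`8` bit; `2B`/`2Cs` are one value `borel`) × `CMTwo`
  (none / split / inert / ramified = behaviour of `2` in the CM field, census `p_in_cm_field`):
  `2·5·4·4 = 160` cells; `HoldsAt`, `cellAtTwoOf`, exhaustive (`holdsAt_cellAtTwoOf`) and disjoint
  (`eq_cellAtTwoOf_of_holdsAt`). The twist-family axis (`orbit_id`) has infinitely many values and
  is typed as a class schema in `P2/WindowsAtTwo.lean`, not as a grid axis.
* Sequel `P2/CellsAtTwoStatus.lean`: consistency of cells (tree theorems), the per-cell statement
  `BSDTwoOnCell c`, `BSDTwoRankLeOne ↔ ∀ c, BSDTwoOnCell c`, the STATUS table with soundness and counts.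

References: Miller, LMS J. Comput. Math. 14 (2011) Def. 1.1 [Miller2011LMS]; Dokchitser–Dokchitser,
Math. Z. 272 (2012) [DokchitserDokchitserMathZ2012]; HOME/p2/PLAN.md §0–§1; class-closure/O1/TYPING.md.
-/

noncomputable section

open scoped Classical

open WeierstrassCurve Literature.NumberTheory.EllipticCurves
  Literature.NumberTheory.EllipticCurves.Rank1Residual
  Literature.NumberTheory.EllipticCurves.Rank1Residual.Typed

set_option autoImplicit false

namespace Summit.BirchSwinnertonDyer.Rank1Residual.P2

/-! ## §0 The schema: a class at `2` and its exact BSD-at-2 statement -/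

/-- A *class of the partition at `2`*: a predicate on elliptic curves over `ℚ` given by a globally
minimal Weierstrass model (tree convention: `a_p`, `Δ_min`, `shaAn` are read on it). [folklore] -/
abbrev ClassAtTwo : Type :=
  ∀ (W : WeierstrassCurve ℚ) [W.IsElliptic] [W.IsGloballyMinimal], Prop

/-- **The exact BSD-at-2 statement of a class `C`** (the lane's unit of aim, PLAN.md §0): for every
elliptic `E/ℚ` of analytic rank `≤ 1` in the class, Miller's `BSD(E,2)` (`BSDp W 2`: rank part,
finiteness of `Ш(2)`, `#Ш_an ∈ ℚ` and `ord₂ #Ш_an = ord₂ #Ш(E)(2)`). A TARGET schema; nothing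
asserted. [cite: Miller2011LMS, Def. 1.1 (arXiv:1010.2431 p. 3)] -/
def BSDTwoOn (C : ClassAtTwo) : Prop :=
  ∀ (W : WeierstrassCurve ℚ) [W.IsElliptic] [W.IsGloballyMinimal],
    W.analyticRank ≤ 1 → C W → BSDp W 2

/-- **TARGET OF RECORD at `2`** (coordinator ruling 2026-08-21T22:39:51Z): `BSD(E,2)` for EVERY
elliptic `E/ℚ` of analytic rank `≤ 1` — the class `⊤`. OPEN; nothing asserted. [cite: Miller2011LMS, Def. 1.1 (arXiv:1010.2431 p. 3)] -/
@[conjecture] def BSDTwoRankLeOne : Prop := BSDTwoOn fun _ _ _ => True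

/-- `BSDTwoOn` is antitone: a statement for a larger class gives the statement for a smaller one.
[folklore] -/
theorem bsdTwoOn_mono {C C' : ClassAtTwo}
    (hle : ∀ (W : WeierstrassCurve ℚ) [W.IsElliptic] [W.IsGloballyMinimal], C W → C' W)
    (h : BSDTwoOn C') : BSDTwoOn C :=
  fun W _ _ hr hC => h W hr (hle W hC)

/-- `BSDTwoOn` is closed under binary union of classes. [folklore] -/
theorem bsdTwoOn_or {C C' : ClassAtTwo} (h : BSDTwoOn C) (h' : BSDTwoOn C') :
    BSDTwoOn fun W _ _ => C W ∨ C' W :=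
  fun W _ _ hr hC => hC.elim (h W hr) (h' W hr)

/-- The target of record gives every class statement. [folklore] -/
theorem bsdTwoOn_of_bsdTwoRankLeOne (h : BSDTwoRankLeOne) (C : ClassAtTwo) : BSDTwoOn C :=
  bsdTwoOn_mono (fun _ _ _ _ => trivial) h

/-- **The census currency.** If EVERY analytic-rank-`≤ 1` member of the class carries the pair datum
`MissingPPartAt W 2` — "`#Ш(E)_an` is a rational `q` with `ord₂ q = ord₂ #Ш(E)`", i.e. PLAN.md §0's
`a₂(E) = s₂(E)` — then the class statement holds (granted Gross–Zagier–Kolyvagin `hGZK`: rank part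
and finiteness of `Ш` in analytic rank `≤ 1`). A per-pair certificate discharges ONE instance of the
hypothesis; the universally quantified hypothesis over an infinite class is exactly what no census
delivers (certificates close pairs, not classes). [cite: Miller2011LMS, §1 and Def. 1.1] -/
theorem bsdTwoOn_of_forall_missingPPartAt (hGZK : rank_eq_analyticRank_of_analyticRank_le_one)
    {C : ClassAtTwo}
    (h : ∀ (W : WeierstrassCurve ℚ) [W.IsElliptic] [W.IsGloballyMinimal],
      W.analyticRank ≤ 1 → C W → MissingPPartAt W 2) :
    BSDTwoOn C :=
  fun W _ _ hr hC => bsdp_of_missingPPartAt W 2 hGZK hr (h W hr hC)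

/-- Conversely a class statement yields the pair datum on every member (GZK for the finiteness of
`Ш`). [cite: Miller2011LMS, Def. 1.1] -/
theorem missingPPartAt_of_bsdTwoOn (hGZK : rank_eq_analyticRank_of_analyticRank_le_one)
    {C : ClassAtTwo} (h : BSDTwoOn C) (W : WeierstrassCurve ℚ) [W.IsElliptic] [W.IsGloballyMinimal]
    (hr : W.analyticRank ≤ 1) (hC : C W) : MissingPPartAt W 2 := by
  haveI : Finite W.sha := (hGZK W hr).2
  exact missingPPartAt_of_bsdp W 2 (h W hr hC)

/-! ## §1 The grid of cells at `2` -/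

/-- Reduction type at `2` (census column `red_E`; O1's five sub-cells). [folklore] -/
inductive RedTwo
  | goodOrd | goodSS | multSplit | multNonsplit | addv
  deriving DecidableEq, Repr

/-- Image of Galois at `2` at grid resolution (census columns `img_E` and `surj8`): `surj8` =
`ρ̄_{E,2}` onto `S₃` AND `ρ̄_{E,8}` onto (hence `ρ_{E,2^∞}` onto `GL₂(ℤ₂)`, Dokchitser–Dokchitser
2012); `surjNot8` = `ρ̄_{E,2}` onto, `ρ̄_{E,8}` not; `cyclic3` = `E[2]` irreducible, image `C₃`
(census `2Cn`); `borel` = a rational `2`-torsion point (census `2B` ∪ `2Cs`).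
[cite: DokchitserDokchitserMathZ2012, Theorem and Introduction] -/
inductive ImgTwo
  | surj8 | surjNot8 | cyclic3 | borel
  deriving DecidableEq, Repr

/-- CM axis at `2` (census columns `cm_disc` / `p_in_cm_field`): no CM, or CM with `2` split /
inert / ramified in the CM field `K` (read off `j`, `cmFieldDiscrOfJ`). [folklore] -/
inductive CMTwo
  | none | split | inert | ramified
  deriving DecidableEq, Repr

/-- A **cell of the partition at `2`**: analytic-rank bit (`r1 = true` ⟺ `r_an = 1`, else `r_an = 0`)
× reduction at `2` × image at `2` × CM at `2`. `160` cells. [folklore] -/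
structure CellAtTwo where
  /-- `true` ⟺ analytic rank `1`; `false` ⟺ analytic rank `0`. -/
  r1 : Bool
  /-- Reduction type at `2`. -/
  red : RedTwo
  /-- Image of Galois at `2` (grid resolution). -/
  img : ImgTwo
  /-- CM and the behaviour of `2` in the CM field. -/
  cm : CMTwo
  deriving DecidableEq, Repr

section HoldsAt

variable (W : WeierstrassCurve ℚ) [W.IsElliptic] [W.IsGloballyMinimal]

/-- The reduction value holds at `W`: literally O1's sub-cell predicates `X5.O1.CellGoodOrd`
(`= GoodOrd W 2`), `CellGoodSS`, `CellMultSplit` (split multiplicative at `2`), `CellMultNonsplit`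
(`Mult W 2 ∧ ¬split`), `CellAddv` (`= Addv W 2`). [folklore] -/
def RedTwo.HoldsAt : RedTwo → Prop
  | .goodOrd => X5.O1.CellGoodOrd W
  | .goodSS => X5.O1.CellGoodSS W
  | .multSplit => X5.O1.CellMultSplit W
  | .multNonsplit => X5.O1.CellMultNonsplit W
  | .addv => X5.O1.CellAddv W

/-- The image value holds at `W` (`Surj W 2`, O1's `SurjModEight`, `Irr W 2`, O1's
`RationalTwoTorsion W = Red W 2`). [cite: DokchitserDokchitserMathZ2012, Theorem] -/
def ImgTwo.HoldsAt : ImgTwo → Prop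
  | .surj8 => Surj W 2 ∧ X5.O1.SurjModEight W
  | .surjNot8 => Surj W 2 ∧ ¬ X5.O1.SurjModEight W
  | .cyclic3 => Irr W 2 ∧ ¬ Surj W 2
  | .borel => X5.O1.RationalTwoTorsion W

omit [W.IsGloballyMinimal] in
/-- The CM value holds at `W` (`W.HasCM`, `CMSplit / CMInert / CMRamified W 2`). [folklore] -/
def CMTwo.HoldsAt : CMTwo → Prop
  | .none => ¬ W.HasCM
  | .split => W.HasCM ∧ CMSplit W 2
  | .inert => W.HasCM ∧ CMInert W 2
  | .ramified => W.HasCM ∧ CMRamified W 2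

omit [W.IsElliptic] [W.IsGloballyMinimal] in
/-- The rank bit holds at `W`. [folklore] -/
def RankBitHoldsAt (r1 : Bool) : Prop := W.analyticRank = r1.toNat

/-- **The cell `c` holds at `W`** = the class predicate of the cell (hypotheses = the class
conditions, each a tree predicate). [folklore] -/
def CellAtTwo.HoldsAt (c : CellAtTwo) : Prop :=
  RankBitHoldsAt W c.r1 ∧ c.red.HoldsAt W ∧ c.img.HoldsAt W ∧ c.cm.HoldsAt W

/-- The reduction value of `W` at `2` (classical case split, O1's order). [folklore] -/
def redAtTwoOf : RedTwo :=
  if X5.O1.CellGoodOrd W then .goodOrd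
  else if X5.O1.CellGoodSS W then .goodSS
  else if X5.O1.CellMultSplit W then .multSplit
  else if Mult W 2 then .multNonsplit
  else .addv

/-- The image value of `W` at `2`. [folklore] -/
def imgAtTwoOf : ImgTwo :=
  if Surj W 2 then (if X5.O1.SurjModEight W then .surj8 else .surjNot8)
  else if Irr W 2 then .cyclic3
  else .borel

omit [W.IsGloballyMinimal] in
/-- The CM value of `W` at `2`. [folklore] -/
def cmAtTwoOf : CMTwo :=
  if ¬ W.HasCM then .none
  else if CMSplit W 2 then .split
  else if CMRamified W 2 then .ramified
  else .inert

/-- **The cell of `W` at `2`.** [folklore] -/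
def cellAtTwoOf : CellAtTwo :=
  ⟨decide (W.analyticRank = 1), redAtTwoOf W, imgAtTwoOf W, cmAtTwoOf W⟩

omit [W.IsElliptic] in
/-- The reduction value of `W` holds at `W` (exhaustiveness of O1's five sub-cells:
`Addv = ¬Good ∧ ¬Mult`, `Good = GoodOrd ∨ GoodSS`). [folklore] -/
theorem redAtTwoOf_holdsAt : (redAtTwoOf W).HoldsAt W := by
  unfold redAtTwoOf
  by_cases hgo : X5.O1.CellGoodOrd W
  · rw [if_pos hgo]; exact hgo
  rw [if_neg hgo]
  by_cases hss : X5.O1.CellGoodSS W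
  · rw [if_pos hss]; exact hss
  rw [if_neg hss]
  by_cases hsp : X5.O1.CellMultSplit W
  · rw [if_pos hsp]; exact hsp
  rw [if_neg hsp]
  by_cases hm : Mult W 2
  · rw [if_pos hm]; exact ⟨hm, hsp⟩
  rw [if_neg hm]
  refine ⟨fun hg => ?_, hm⟩
  by_cases ha : (2 : ℤ) ∣ W.frobeniusTrace 2
  · exact hss ⟨hg, ha⟩
  · exact hgo ⟨hg, ha⟩

omit [W.IsElliptic] [W.IsGloballyMinimal] in
/-- The image value of `W` holds at `W`. [folklore] -/
theorem imgAtTwoOf_holdsAt : (imgAtTwoOf W).HoldsAt W := by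
  unfold imgAtTwoOf
  by_cases hs : Surj W 2
  · rw [if_pos hs]
    by_cases h8 : X5.O1.SurjModEight W
    · rw [if_pos h8]; exact ⟨hs, h8⟩
    · rw [if_neg h8]; exact ⟨hs, h8⟩
  rw [if_neg hs]
  by_cases hi : Irr W 2
  · rw [if_pos hi]; exact ⟨hi, hs⟩
  · rw [if_neg hi]; exact hi

omit [W.IsGloballyMinimal] in
/-- The CM value of `W` holds at `W` (`CMInert = ¬ramified ∧ ¬split`). [folklore] -/
theorem cmAtTwoOf_holdsAt : (cmAtTwoOf W).HoldsAt W := by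
  unfold cmAtTwoOf
  by_cases hcm : W.HasCM
  · rw [if_neg (not_not_intro hcm)]
    by_cases hsp : CMSplit W 2
    · rw [if_pos hsp]; exact ⟨hcm, hsp⟩
    rw [if_neg hsp]
    by_cases hram : CMRamified W 2
    · rw [if_pos hram]; exact ⟨hcm, hram⟩
    · rw [if_neg hram]; exact ⟨hcm, hram, hsp⟩
  · rw [if_pos hcm]; exact hcm

/-- **EXHAUSTIVE: every curve of analytic rank `≤ 1` lies in its cell.** [folklore] -/
theorem holdsAt_cellAtTwoOf (hr : W.analyticRank ≤ 1) : (cellAtTwoOf W).HoldsAt W := by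
  refine ⟨?_, redAtTwoOf_holdsAt W, imgAtTwoOf_holdsAt W, cmAtTwoOf_holdsAt W⟩
  show W.analyticRank = (decide (W.analyticRank = 1)).toNat
  by_cases h1 : W.analyticRank = 1
  · rw [decide_eq_true h1, Bool.toNat_true]; exact h1
  · rw [decide_eq_false h1, Bool.toNat_false]; omega

omit [W.IsElliptic] in
/-- Cells are DISJOINT on the reduction axis (split ⇒ multiplicative; good ⇒ not multiplicative).
[folklore] -/
theorem RedTwo.eq_of_holdsAt {s t : RedTwo} (hs : s.HoldsAt W) (ht : t.HoldsAt W) : s = t := by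
  have key : ∀ u : RedTwo, u.HoldsAt W → u = redAtTwoOf W := by
    intro u hu
    have ngm : Good W 2 → ¬ Mult W 2 := fun hg => not_mult_of_good W 2 hg
    unfold redAtTwoOf
    cases u with
    | goodOrd => exact (if_pos (show X5.O1.CellGoodOrd W from hu)).symm
    | goodSS =>
      have h1 : ¬ X5.O1.CellGoodOrd W := fun h => h.2 hu.2
      rw [if_neg h1, if_pos (show X5.O1.CellGoodSS W from hu)]
    | multSplit =>
      have hm : Mult W 2 := hu.hasMultiplicativeReductionAtPrime
      have h1 : ¬ X5.O1.CellGoodOrd W := fun h => ngm h.1 hm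
      have h2 : ¬ X5.O1.CellGoodSS W := fun h => ngm h.1 hm
      rw [if_neg h1, if_neg h2, if_pos (show X5.O1.CellMultSplit W from hu)]
    | multNonsplit =>
      have h1 : ¬ X5.O1.CellGoodOrd W := fun h => ngm h.1 hu.1
      have h2 : ¬ X5.O1.CellGoodSS W := fun h => ngm h.1 hu.1
      rw [if_neg h1, if_neg h2, if_neg (show ¬ X5.O1.CellMultSplit W from hu.2),
        if_pos (show Mult W 2 from hu.1)]
    | addv =>
      have h1 : ¬ X5.O1.CellGoodOrd W := fun h => hu.1 h.1
      have h2 : ¬ X5.O1.CellGoodSS W := fun h => hu.1 h.1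
      have h3 : ¬ X5.O1.CellMultSplit W := fun h => hu.2 h.hasMultiplicativeReductionAtPrime
      rw [if_neg h1, if_neg h2, if_neg h3, if_neg (show ¬ Mult W 2 from hu.2)]
  rw [key s hs, key t ht]

omit [W.IsGloballyMinimal] in
/-- Cells are disjoint on the image axis (surjective ⇒ irreducible). [folklore] -/
theorem ImgTwo.eq_of_holdsAt {s t : ImgTwo} (hs : s.HoldsAt W) (ht : t.HoldsAt W) : s = t := by
  have key : ∀ u : ImgTwo, u.HoldsAt W → u = imgAtTwoOf W := by
    intro u hu
    unfold imgAtTwoOf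
    cases u with
    | surj8 => rw [if_pos hu.1, if_pos hu.2]
    | surjNot8 => rw [if_pos hu.1, if_neg hu.2]
    | cyclic3 => rw [if_neg hu.2, if_pos hu.1]
    | borel =>
      have hi : ¬ Irr W 2 := hu
      have hs' : ¬ Surj W 2 := fun h => hi (irr_of_surj W 2 h)
      rw [if_neg hs', if_neg hi]
  rw [key s hs, key t ht]

omit [W.IsGloballyMinimal] in
/-- Cells are disjoint on the CM axis. [folklore] -/
theorem CMTwo.eq_of_holdsAt {s t : CMTwo} (hs : s.HoldsAt W) (ht : t.HoldsAt W) : s = t := by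
  have key : ∀ u : CMTwo, u.HoldsAt W → u = cmAtTwoOf W := by
    intro u hu
    unfold cmAtTwoOf
    cases u with
    | none => exact (if_pos (show ¬ W.HasCM from hu)).symm
    | split => rw [if_neg (not_not_intro hu.1), if_pos hu.2]
    | inert => rw [if_neg (not_not_intro hu.1), if_neg hu.2.2, if_neg hu.2.1]
    | ramified =>
      have hns : ¬ CMSplit W 2 := fun h => h.1 hu.2
      rw [if_neg (not_not_intro hu.1), if_neg hns, if_pos hu.2]
  rw [key s hs, key t ht]

/-- **DISJOINT: a curve lies in at most one cell** — the grid is a partition of the analytic-rank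
`≤ 1` curves at `2`. [folklore] -/
theorem eq_cellAtTwoOf_of_holdsAt {c : CellAtTwo} (hc : c.HoldsAt W) : c = cellAtTwoOf W := by
  obtain ⟨hrk, hred, himg, hcm⟩ := hc
  obtain ⟨r1, red, img, cm⟩ := c
  simp only at hrk hred himg hcm
  have hr : W.analyticRank ≤ 1 := by
    cases r1
    · simp only [RankBitHoldsAt, Bool.toNat_false] at hrk; omega
    · simp only [RankBitHoldsAt, Bool.toNat_true] at hrk; omega
  obtain ⟨-, hred', himg', hcm'⟩ := holdsAt_cellAtTwoOf W hr
  have e1 : r1 = decide (W.analyticRank = 1) := by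
    cases r1
    · simp only [RankBitHoldsAt, Bool.toNat_false] at hrk
      rw [decide_eq_false (by omega)]
    · simp only [RankBitHoldsAt, Bool.toNat_true] at hrk
      rw [decide_eq_true hrk]
  have e2 : red = redAtTwoOf W := RedTwo.eq_of_holdsAt W hred hred'
  have e3 : img = imgAtTwoOf W := ImgTwo.eq_of_holdsAt W himg himg'
  have e4 : cm = cmAtTwoOf W := CMTwo.eq_of_holdsAt W hcm hcm'
  subst e1 e2 e3 e4
  rfl

/-! ### Enumeration of the grid (for kernel `decide` over all cells) -/

/-- The five reduction values. [folklore] -/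
def RedTwo.all : List RedTwo := [.goodOrd, .goodSS, .multSplit, .multNonsplit, .addv]

/-- The four image values. [folklore] -/
def ImgTwo.all : List ImgTwo := [.surj8, .surjNot8, .cyclic3, .borel]

/-- The four CM values. [folklore] -/
def CMTwo.all : List CMTwo := [.none, .split, .inert, .ramified]

/-- The list of all `160` cells. [folklore] -/
def CellAtTwo.all : List CellAtTwo :=
  [false, true].flatMap fun r => RedTwo.all.flatMap fun s => ImgTwo.all.flatMap fun i =>
    CMTwo.all.map fun k => ⟨r, s, i, k⟩

/-- Every cell is listed. [folklore] -/
theorem CellAtTwo.mem_all (c : CellAtTwo) : c ∈ CellAtTwo.all := by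
  obtain ⟨r, s, i, k⟩ := c
  simp only [CellAtTwo.all, RedTwo.all, ImgTwo.all, CMTwo.all, List.mem_flatMap, List.mem_map,
    List.mem_cons, List.not_mem_nil, or_false, CellAtTwo.mk.injEq]
  exact ⟨r, by cases r <;> simp, s, by cases s <;> simp, i, by cases i <;> simp, k,
    by cases k <;> simp, rfl, rfl, rfl, rfl⟩

/-- `∀` over the cells is decidable by enumeration of `CellAtTwo.all`. [folklore] -/
instance CellAtTwo.decidableForall (P : CellAtTwo → Prop) [DecidablePred P] :
    Decidable (∀ c, P c) :=
  decidable_of_iff (∀ c ∈ CellAtTwo.all, P c)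
    ⟨fun h c => h c (CellAtTwo.mem_all c), fun h c _ => h c⟩

/-- The grid has `160` cells. [folklore] -/
theorem CellAtTwo.length_all : CellAtTwo.all.length = 160 := by decide +kernel

end HoldsAt

end Summit.BirchSwinnertonDyer.Rank1Residual.P2

end
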